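import Summits.CriticalPhenomena.PercolationContinuityZ3.Theorems.PercNearOneGluingNoHeavyLowerTailAPLConjFForestMeasure
import HarnessLib

/-!
# `NoHeavyLowerTail` (stmt-CriticalPhenomena-4575) — THEOREM F_T, quotable corollaries: CONJECTURE F in one line, APL(2/3), Gladkov–Zimin 6.3 on forests

Support file (prover prim-ineq-gen-8 gen 36; `--supports stmt-CriticalPhenomena-4575`; memo
run/shared/lean/prim/prim-ineq-gen-8/FINDING-gen36-LEMMA-U.md §6).  No definitions, no named facts, no sorries.

`μ = prodBernoulli w` on the pairs of a finite vertex type, distinct `a, b, c`, the positive-weight non-loop pairs avoiding `b, c` forming an acyclic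
graph ("`G ∖ {b,c}` is a forest"); cells `u0 = μ(a|b|c)`, `uab = μ(ab|c)`, `uac = μ(ac|b)`, `ubc = μ(a|bc)`, `u3 = μ(a↔b ∧ a↔c)`, `e = uab+uac`,
`D = u0+e = μ(b ↮ c)`, `T = e+u3 = μ(a↔b ∨ a↔c)`.
* `prodBernoulli_cells_sum_eq_one` — the five cells sum to `1` (for every `w`).
* `conjF_forest_oneLine` — prim-cert-1's CONJECTURE F (g13 §12, the K6/K7 facet pair F25/F26) ON FORESTS:
  `2·u0·u3 ≤ e·u3 + 3e·ubc + 2·min(uab, uac)·D`.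
* `apl23_forest` — APL(2/3) ON FORESTS: `2·T·D ≤ 3e`, i.e. `μ(ab|c) + μ(ac|b) ≥ (2/3)·μ(b ↮ c)·μ(a ↔ b ∨ a ↔ c)` (gen 29 COROLLARY B; prove-5 g35's
  conjectured sharp constant).
* `gz63_forest` — the quantitative Gladkov–Zimin Conjecture 6.3 / Gladkov Conjecture 10.1 ON FORESTS:
  `μ(abc) − μ(ac)μ(bc) ≤ sqrt(μ(ab|c)μ(ac|b)) + μ(ab|c)·μ(bc)` (`gz63_of_geom`).
[this work]
-/

namespace Summit.CriticalPhenomena.PercolationContinuityZ3.Theorems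

namespace APL

open MeasureTheory Literature.Probability.Percolation Literature.Probability.Percolation.Gladkov
  Literature.Probability.Percolation.DecisionTree Literature.Probability.LatticeModels
open scoped Classical

variable {V : Type*} [Fintype V]

/-- The five connection cells of `prodBernoulli w` sum to one. [folklore] -/
theorem prodBernoulli_cells_sum_eq_one (w : Sym2 V → unitInterval) (a b c : V) :
    (prodBernoulli w).real ((openConn a b)ᶜ ∩ (openConn a c)ᶜ ∩ (openConn b c)ᶜ) + (prodBernoulli w).real (openConn a b ∩ (openConn a c)ᶜ) + (prodBernoulli w).real (openConn a c ∩ (openConn a b)ᶜ)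
      + (prodBernoulli w).real ((openConn a b)ᶜ ∩ (openConn a c)ᶜ ∩ openConn b c) + (prodBernoulli w).real (openConn a b ∩ openConn a c) = 1 := by
  have hcl : ∀ (S : Finset (Sym2 V)) (u v : V), (↑S : Set (Sym2 V)) ∈ openConn u v ↔ v ∈ cl S u :=
    fun S u v => by rw [mem_cl]; rfl
  have c_zero : (prodBernoulli w).real ((openConn a b)ᶜ ∩ (openConn a c)ᶜ ∩ (openConn b c)ᶜ)
      = PrW (Finset.univ.filter fun e : Sym2 V => ¬ e.IsDiag ∧ 0 < (w e : ℝ)) (fun e => (w e : ℝ)) {K : Finset (Sym2 V) | b ∉ cl K a ∧ c ∉ cl K a ∧ c ∉ cl K b} := by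
    rw [prodBernoulli_real_eq_PrW_univ w (X := {K : Finset (Sym2 V) | b ∉ cl K a ∧ c ∉ cl K a ∧ c ∉ cl K b}) fun S => by
      simp only [Set.mem_setOf_eq, Set.mem_inter_iff, Set.mem_compl_iff, hcl, and_assoc]]
    exact PrW_univ_eq_support w {K : Finset (Sym2 V) | b ∉ cl K a ∧ c ∉ cl K a ∧ c ∉ cl K b} fun S T hT => by
      simp only [Set.mem_setOf_eq, cl_union_diag S T hT]
  have c_ab : (prodBernoulli w).real (openConn a b ∩ (openConn a c)ᶜ)
      = PrW (Finset.univ.filter fun e : Sym2 V => ¬ e.IsDiag ∧ 0 < (w e : ℝ)) (fun e => (w e : ℝ)) {K : Finset (Sym2 V) | b ∈ cl K a ∧ c ∉ cl K a} := by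
    rw [prodBernoulli_real_eq_PrW_univ w (X := {K : Finset (Sym2 V) | b ∈ cl K a ∧ c ∉ cl K a}) fun S => by
      simp only [Set.mem_setOf_eq, Set.mem_inter_iff, Set.mem_compl_iff, hcl]]
    exact PrW_univ_eq_support w {K : Finset (Sym2 V) | b ∈ cl K a ∧ c ∉ cl K a} fun S T hT => by
      simp only [Set.mem_setOf_eq, cl_union_diag S T hT]
  have c_ac : (prodBernoulli w).real (openConn a c ∩ (openConn a b)ᶜ)
      = PrW (Finset.univ.filter fun e : Sym2 V => ¬ e.IsDiag ∧ 0 < (w e : ℝ)) (fun e => (w e : ℝ)) {K : Finset (Sym2 V) | c ∈ cl K a ∧ b ∉ cl K a} := by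
    rw [prodBernoulli_real_eq_PrW_univ w (X := {K : Finset (Sym2 V) | c ∈ cl K a ∧ b ∉ cl K a}) fun S => by
      simp only [Set.mem_setOf_eq, Set.mem_inter_iff, Set.mem_compl_iff, hcl]]
    exact PrW_univ_eq_support w {K : Finset (Sym2 V) | c ∈ cl K a ∧ b ∉ cl K a} fun S T hT => by
      simp only [Set.mem_setOf_eq, cl_union_diag S T hT]
  have c_bc : (prodBernoulli w).real ((openConn a b)ᶜ ∩ (openConn a c)ᶜ ∩ openConn b c)
      = PrW (Finset.univ.filter fun e : Sym2 V => ¬ e.IsDiag ∧ 0 < (w e : ℝ)) (fun e => (w e : ℝ)) {K : Finset (Sym2 V) | b ∉ cl K a ∧ c ∉ cl K a ∧ c ∈ cl K b} := by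
    rw [prodBernoulli_real_eq_PrW_univ w (X := {K : Finset (Sym2 V) | b ∉ cl K a ∧ c ∉ cl K a ∧ c ∈ cl K b}) fun S => by
      simp only [Set.mem_setOf_eq, Set.mem_inter_iff, Set.mem_compl_iff, hcl, and_assoc]]
    exact PrW_univ_eq_support w {K : Finset (Sym2 V) | b ∉ cl K a ∧ c ∉ cl K a ∧ c ∈ cl K b} fun S T hT => by
      simp only [Set.mem_setOf_eq, cl_union_diag S T hT]
  have c_three : (prodBernoulli w).real (openConn a b ∩ openConn a c)
      = PrW (Finset.univ.filter fun e : Sym2 V => ¬ e.IsDiag ∧ 0 < (w e : ℝ)) (fun e => (w e : ℝ)) {K : Finset (Sym2 V) | b ∈ cl K a ∧ c ∈ cl K a} := by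
    rw [prodBernoulli_real_eq_PrW_univ w (X := {K : Finset (Sym2 V) | b ∈ cl K a ∧ c ∈ cl K a}) fun S => by
      simp only [Set.mem_setOf_eq, Set.mem_inter_iff, hcl]]
    exact PrW_univ_eq_support w {K : Finset (Sym2 V) | b ∈ cl K a ∧ c ∈ cl K a} fun S T hT => by
      simp only [Set.mem_setOf_eq, cl_union_diag S T hT]
  rw [c_zero, c_ab, c_ac, c_bc, c_three]
  exact cells_sum_eq_one _ _ a b c

/-- **CONJECTURE F on forests, one-line form**: `2·u0·u3 ≤ e·u3 + 3e·ubc + 2·min(uab,uac)·D`. [this work] -/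
theorem conjF_forest_oneLine (w : Sym2 V → unitInterval) (a b c : V) (hab : a ≠ b) (hac : a ≠ c) (hbc : b ≠ c)
    (hforest : (openGraph (↑((Finset.univ.filter fun e : Sym2 V => ¬ e.IsDiag ∧ 0 < (w e : ℝ)).filter fun f => b ∉ f ∧ c ∉ f) : Set (Sym2 V))).IsAcyclic) :
    2 * (prodBernoulli w).real ((openConn a b)ᶜ ∩ (openConn a c)ᶜ ∩ (openConn b c)ᶜ) * (prodBernoulli w).real (openConn a b ∩ openConn a c)
      ≤ ((prodBernoulli w).real (openConn a b ∩ (openConn a c)ᶜ) + (prodBernoulli w).real (openConn a c ∩ (openConn a b)ᶜ)) * (prodBernoulli w).real (openConn a b ∩ openConn a c)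
        + 3 * ((prodBernoulli w).real (openConn a b ∩ (openConn a c)ᶜ) + (prodBernoulli w).real (openConn a c ∩ (openConn a b)ᶜ)) * (prodBernoulli w).real ((openConn a b)ᶜ ∩ (openConn a c)ᶜ ∩ openConn b c)
        + 2 * min ((prodBernoulli w).real (openConn a b ∩ (openConn a c)ᶜ)) ((prodBernoulli w).real (openConn a c ∩ (openConn a b)ᶜ))
          * ((prodBernoulli w).real ((openConn a b)ᶜ ∩ (openConn a c)ᶜ ∩ (openConn b c)ᶜ) + (prodBernoulli w).real (openConn a b ∩ (openConn a c)ᶜ) + (prodBernoulli w).real (openConn a c ∩ (openConn a b)ᶜ)) := by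
  obtain ⟨hb, hc, _, _⟩ := conjF_forest_prodBernoulli w a b c hab hac hbc hforest
  rcases min_choice ((prodBernoulli w).real (openConn a b ∩ (openConn a c)ᶜ)) ((prodBernoulli w).real (openConn a c ∩ (openConn a b)ᶜ)) with hmin | hmin <;> rw [hmin]
  · linear_combination hb
  · linear_combination hc

/-- **APL(2/3) on forests**: `2·μ(a↔b ∨ a↔c)·μ(b ↮ c) ≤ 3·(μ(ab|c) + μ(ac|b))` (with `T = e + u3`, `D = u0 + e` in cells). [this work] -/
theorem apl23_forest (w : Sym2 V → unitInterval) (a b c : V) (hab : a ≠ b) (hac : a ≠ c) (hbc : b ≠ c)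
    (hforest : (openGraph (↑((Finset.univ.filter fun e : Sym2 V => ¬ e.IsDiag ∧ 0 < (w e : ℝ)).filter fun f => b ∉ f ∧ c ∉ f) : Set (Sym2 V))).IsAcyclic) :
    2 * (((prodBernoulli w).real (openConn a b ∩ (openConn a c)ᶜ) + (prodBernoulli w).real (openConn a c ∩ (openConn a b)ᶜ) + (prodBernoulli w).real (openConn a b ∩ openConn a c))
        * ((prodBernoulli w).real ((openConn a b)ᶜ ∩ (openConn a c)ᶜ ∩ (openConn b c)ᶜ) + (prodBernoulli w).real (openConn a b ∩ (openConn a c)ᶜ) + (prodBernoulli w).real (openConn a c ∩ (openConn a b)ᶜ)))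
      ≤ 3 * ((prodBernoulli w).real (openConn a b ∩ (openConn a c)ᶜ) + (prodBernoulli w).real (openConn a c ∩ (openConn a b)ᶜ)) := by
  obtain ⟨_, _, _, hG⟩ := conjF_forest_prodBernoulli w a b c hab hac hbc hforest
  have hs := prodBernoulli_cells_sum_eq_one w a b c
  rw [hs, mul_one, one_pow, mul_one] at hG
  exact apl23_of_geom _ _ _ _ measureReal_nonneg measureReal_nonneg hG

/-- **Quantitative Gladkov–Zimin Conjecture 6.3 on forests**: `u3 − (uac+u3)(ubc+u3) ≤ sqrt(uab·uac) + uab·(ubc+u3)`, i.e.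
`μ(a↔b, a↔c) − μ(a↔c)μ(b↔c) ≤ sqrt(μ(ab|c)μ(ac|b)) + μ(ab|c)μ(b↔c)`. [this work] -/
theorem gz63_forest (w : Sym2 V → unitInterval) (a b c : V) (hab : a ≠ b) (hac : a ≠ c) (hbc : b ≠ c)
    (hforest : (openGraph (↑((Finset.univ.filter fun e : Sym2 V => ¬ e.IsDiag ∧ 0 < (w e : ℝ)).filter fun f => b ∉ f ∧ c ∉ f) : Set (Sym2 V))).IsAcyclic) :
    (prodBernoulli w).real (openConn a b ∩ openConn a c) - ((prodBernoulli w).real (openConn a c ∩ (openConn a b)ᶜ) + (prodBernoulli w).real (openConn a b ∩ openConn a c)) * ((prodBernoulli w).real ((openConn a b)ᶜ ∩ (openConn a c)ᶜ ∩ openConn b c) + (prodBernoulli w).real (openConn a b ∩ openConn a c))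
      ≤ Real.sqrt ((prodBernoulli w).real (openConn a b ∩ (openConn a c)ᶜ) * (prodBernoulli w).real (openConn a c ∩ (openConn a b)ᶜ))
        + (prodBernoulli w).real (openConn a b ∩ (openConn a c)ᶜ) * ((prodBernoulli w).real ((openConn a b)ᶜ ∩ (openConn a c)ᶜ ∩ openConn b c) + (prodBernoulli w).real (openConn a b ∩ openConn a c)) := by
  obtain ⟨_, _, _, hG⟩ := conjF_forest_prodBernoulli w a b c hab hac hbc hforest
  have hs := prodBernoulli_cells_sum_eq_one w a b c
  rw [hs, mul_one, one_pow, mul_one] at hG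
  exact gz63_of_geom _ _ _ _ _ hs hG

end APL

end Summit.CriticalPhenomena.PercolationContinuityZ3.Theorems
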